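import Literature.NumberTheory.Automorphic.AutomorphicFormsL2Derivative
import Literature.NumberTheory.Automorphic.AutomorphicFormsGLContinuous
import Literature.NumberTheory.Automorphic.ArchimedeanLieDerivSmooth
import Literature.NumberTheory.Automorphic.ArchimedeanLieDerivKFinite
import Literature.NumberTheory.Automorphic.ArchimedeanEnvelopingAction
import Literature.NumberTheory.Automorphic.GLnCuspidalSpectrumSiegelProofs
import Literature.NumberTheory.Automorphic.UnramifiedHeckeScalarsProofs
import HarnessLib

/-!
# Lie derivatives of test functions on `GL_n(𝔸_K)`: smooth kernels, their levels, supports and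
uniform bounds
(Borel, *Automorphic forms on `SL₂(ℝ)`* (1997), §2.1–2.2 (left and right invariant differential
operators, `D(f * φ) = f * Dφ`), §5.3 and Lemma 7.4, PDF pp. 48–50, 60–61 of the held copy;
Borel–Jacquet, *Automorphic forms and automorphic representations* (1979), §1.5, §4.1)

A brick of the derivative route to the basic estimate for cusp forms on a Siegel set of `GL_n`
(`GLnCuspidalSpectrum.norm_smoothedForm_le_of_isSiegelSetGL` of `GLnCuspidalSpectrumSiegel`). The
estimate differentiates the smoothed form `R(η) f` along the unipotent radical, which lands the
right Lie derivatives `X₁ ⋯ X_B η` of the test function `η` inside the smoothing integral. This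
file supplies the calculus of these derived weights, for the `GL_n` datum (`AutomorphyDatum.gl`,
`glArch = (g_∞ ↦ (g_∞, 1))`):

* `IsSmoothKernelGL n K η` — **smooth kernels**: complex functions on `GL_n(𝔸_K)` that are smooth
  in the archimedean variable (`IsArchSmooth`), compactly supported, and right invariant under an
  admissible level (`finiteLevelsGL`); they are continuous
  (`continuous_of_isArchSmooth_of_isRightInvariantUnder` of `AutomorphicFormsGLContinuous`) and
  bounded. The complexification of a test function (`IsTestFunctionGL`) is a smooth kernel.
* **Closure under Lie derivatives**: `IsSmoothKernelGL.lieDeriv`, `.iterLieDeriv` — the right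
  derivative `X η` (`lieDeriv` of `ArchimedeanCalculus`) of a smooth kernel is a smooth kernel
  (smoothness: `IsArchSmooth.lieDeriv_gl`; support: `support (X φ) ⊆ tsupport φ`; level: the
  archimedean one-parameter subgroups commute with the finite level).
* **Left invariance**: a compactly supported function right invariant under an admissible level
  is *left* invariant under a principal congruence subgroup
  (`exists_isLeftInvariant_of_isRightInvariantUnder`; uniform continuity of conjugation on the
  compact support and `exists_principalCongruenceLevel_subset`), and left invariance passes to all
  right derivatives (`IsLeftInvariantUnder.iterLieDeriv_gl`,
  `IsSmoothKernelGL.exists_isLeftInvariant_iterLieDeriv`).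
* **Iterated derivatives** `v₀ ⋯ v_{B-1} η` (`iterLieDeriv` of `List.ofFn v`): smoothness
  (`IsArchSmooth.iterLieDeriv_gl`), linearity in the function (`iterLieDeriv_finset_sum_smul`),
  **homogeneity in the directions** (`IsArchSmooth.iterLieDeriv_ofFn_smul`:
  `(r₀v₀) ⋯ (r_{B-1}v_{B-1}) η = (∏ rᵢ) v₀ ⋯ v_{B-1} η` — the identity that turns the torus scaling
  `Ad(a⁻¹) Y = α(a)⁻¹ · Y'` into the decay `α(a)^{-B}`), the **expansion of the last derivative in
  a real basis of `𝔤𝔩_n(K_∞)`** (`IsArchSmooth.iterLieDeriv_ofFn_succ_eq_sum`, Borel (1997), proof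
  of Lemma 7.4: "`Ad k_x⁻¹(Y) = Σ cᵢ(k_x⁻¹) Xᵢ` … `(-Y * f)(x) = a(x)^{-α} Σ cᵢ(k_x⁻¹) Xᵢ f(x)`"),
  hence **joint continuity** of `(v, g) ↦ (v₀ ⋯ v_{B-1} η)(g)`
  (`IsSmoothKernelGL.continuous_iterLieDeriv_ofFn`) and **uniform bounds over compact sets of
  direction tuples** (`IsSmoothKernelGL.exists_forall_norm_iterLieDeriv_ofFn_le`; Borel: "the
  functions `|cᵢ|` are bounded on `K`").

Everything here is proved.

## References

* A. Borel, *Automorphic forms on `SL₂(ℝ)`*, Cambridge Tracts in Math. 130 (1997), §2.1–2.2,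
  §5.3, 7.4 (PDF pp. 48–50, 60–61 of `book:borelnd-automorphic-forms-sl2-r`) [Borel1997].
* A. Borel, H. Jacquet, *Automorphic forms and automorphic representations*, Proc. Sympos. Pure
  Math. 33 (1979), part 1, §1.5, §4.1 [BorelJacquet1979].
-/

-- Mathlib idiom (Mathlib/Algebra/Lie/OfAssociative.lean); needed to mention Lie subalgebras of matrix algebras
attribute [local instance 100] LieRing.ofAssociativeRing

noncomputable section

open scoped MatrixGroups Matrix ContDiff NNReal Pointwise Classical Topology
open NumberField NumberField.mixedEmbedding IsDedekindDomain Filter Set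

namespace Literature.NumberTheory.Automorphic

variable {n : ℕ} {K : Type} [Field K] [NumberField K]

/-! ### The archimedean inclusion of the `GL_n` datum -/

variable (n K) in
/-- The archimedean inclusion `GL_n(K_∞) →* GL_n(𝔸_K)`, `g_∞ ↦ (g_∞, 1)`, of the `GL_n` automorphy
datum `AutomorphyDatum.gl n K hcpt` with `hcpt` the proved compactness of `GL_n(𝒪̂_K)`
(`isCompact_glFiniteIntegralLevel_holds`); reducible, so that lemmas stated for
`(AutomorphyDatum.gl n K hcpt).ofArch` apply. [folklore] -/
abbrev glArch : (archGroupGL n K).carrier →* GL (Fin n) (AdeleRing (𝓞 K) K) :=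
  (AutomorphyDatum.gl n K (isCompact_glFiniteIntegralLevel_holds n K)).ofArch

/-- `glArch g = GLn.ofInfinite g` (definitional). [folklore] -/
theorem glArch_apply (g : (archGroupGL n K).carrier) :
    glArch n K g = GLn.ofInfinite n K (g : GL (Fin n) (mixedSpace K)) := rfl

/-- The archimedean one-parameter elements commute with the finite-adelic ones
(`GLn.commute_ofInfinite_ofFinite`). [folklore] -/
theorem glArch_mul_ofFinite_comm (g : (archGroupGL n K).carrier)
    (h : GL (Fin n) (FiniteAdeleRing (𝓞 K) K)) :
    glArch n K g * GLn.ofFinite n K h = GLn.ofFinite n K h * glArch n K g :=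
  (GLn.commute_ofInfinite_ofFinite (n := n) (K := K) _ h).eq

/-- Every matrix lies in the Lie algebra of `archGroupGL n K` (which is all of `𝔤𝔩_n(K_∞)`).
[folklore] -/
theorem mem_archGroupGL_lie (X : Matrix (Fin n) (Fin n) (mixedSpace K)) :
    X ∈ (archGroupGL n K).lie := LieSubalgebra.mem_top X

/-- Every element of `GL_n(K_∞)` lies in the carrier of `archGroupGL n K`. [folklore] -/
theorem mem_archGroupGL_carrier (g : GL (Fin n) (mixedSpace K)) :
    g ∈ (archGroupGL n K).carrier := Subgroup.mem_top g

/-- A matrix of `𝔤𝔩_n(K_∞)` as an element of the Lie algebra of `archGroupGL n K`. [folklore] -/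
abbrev lieOf (X : Matrix (Fin n) (Fin n) (mixedSpace K)) : (archGroupGL n K).lie :=
  ⟨X, mem_archGroupGL_lie X⟩

/-- An element of `GL_n(K_∞)` as an element of the carrier of `archGroupGL n K`. [folklore] -/
abbrev carrierOf (g : GL (Fin n) (mixedSpace K)) : (archGroupGL n K).carrier :=
  ⟨g, mem_archGroupGL_carrier g⟩

/-! ### Smooth kernels -/

variable (n K) in
/-- **Smooth kernels on `GL_n(𝔸_K)`**: complex-valued functions which are smooth in the
archimedean variable (`IsArchSmooth` for the `GL_n` datum), compactly supported, and right invariant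
under an admissible level `U ∈ finiteLevelsGL n K` (`U = {1} × U₀`, `U₀ ≤ GL_n(𝔸_K^∞)` compact
open). The complexifications of the test functions `C_c^∞(GL_n(𝔸_K))` of Garrett (2018), §6.3 and
all their right Lie derivatives are smooth kernels. [folklore] -/
structure IsSmoothKernelGL (η : GL (Fin n) (AdeleRing (𝓞 K) K) → ℂ) : Prop where
  isArchSmooth : IsArchSmooth (glArch n K) η
  hasCompactSupport : HasCompactSupport η
  exists_level : ∃ U ∈ finiteLevelsGL n K, IsRightInvariantUnder U η

namespace IsSmoothKernelGL

variable {η : GL (Fin n) (AdeleRing (𝓞 K) K) → ℂ}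

/-- A smooth kernel is continuous (archimedean smoothness and level invariance,
`continuous_of_isArchSmooth_of_isRightInvariantUnder`). [folklore] -/
theorem continuous (hη : IsSmoothKernelGL n K η) : Continuous η := by
  obtain ⟨U, hU, hηU⟩ := hη.exists_level
  exact continuous_of_isArchSmooth_of_isRightInvariantUnder hη.isArchSmooth hU hηU

/-- A smooth kernel is bounded. [folklore] -/
theorem exists_norm_le (hη : IsSmoothKernelGL n K η) : ∃ C : ℝ, 0 ≤ C ∧ ∀ g, ‖η g‖ ≤ C := by
  obtain ⟨C, hC⟩ := hη.continuous.bounded_above_of_compact_support hη.hasCompactSupport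
  exact ⟨max C 0, le_max_right _ _, fun g => (hC g).trans (le_max_left _ _)⟩

/-- Scalar multiples of smooth kernels are smooth kernels. [folklore] -/
theorem smul (hη : IsSmoothKernelGL n K η) (c : ℂ) : IsSmoothKernelGL n K (c • η) := by
  refine ⟨hη.isArchSmooth.smul _ c, hη.hasCompactSupport.smul_left, ?_⟩
  obtain ⟨U, hU, hηU⟩ := hη.exists_level
  exact ⟨U, hU, fun u hu g => by simp only [Pi.smul_apply, hηU u hu g]⟩

end IsSmoothKernelGL

/-- **The complexification of a test function is a smooth kernel.** [folklore] -/
theorem IsTestFunctionGL.isSmoothKernelGL {η : GL (Fin n) (AdeleRing (𝓞 K) K) → ℝ}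
    (hη : IsTestFunctionGL n K η) : IsSmoothKernelGL n K fun g => (η g : ℂ) := by
  refine ⟨hη.isArchSmooth, hη.hasCompactSupport.comp_left Complex.ofReal_zero, ?_⟩
  obtain ⟨U, hU, hinv⟩ := hη.exists_level
  exact ⟨U, hU, fun u hu g => by simp only [hinv u hu g]⟩

/-! ### Supports of Lie derivatives -/

section Support

-- the scoped operator norm on `𝔤𝔩_n(K_∞)` (through which `expGL` is analysed)
set_option backward.isDefEq.respectTransparency false in
open scoped Matrix.Norms.Operator in
/-- The one-parameter subgroup `t ↦ exp(tX)` of `GL_n(K_∞)` is continuous (the statement of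
`continuous_expGL_smul` of `AutomorphicFormsL2DerivativeIntegral`, not imported here). [folklore] -/
private theorem continuous_expGL_smul_aux (X : Matrix (Fin n) (Fin n) (mixedSpace K)) :
    Continuous fun t : ℝ => (expGL (t • X) : GL (Fin n) (mixedSpace K)) := by
  refine Units.continuous_iff.2 ⟨?_, ?_⟩
  · change Continuous fun t : ℝ => ((expGL (t • X) : GL (Fin n) (mixedSpace K)) :
      Matrix (Fin n) (Fin n) (mixedSpace K))
    simp only [coe_expGL]
    exact NormedSpace.exp_continuous.comp (continuous_id.smul continuous_const)
  · change Continuous fun t : ℝ => (((expGL (t • X))⁻¹ : GL (Fin n) (mixedSpace K)) :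
      Matrix (Fin n) (Fin n) (mixedSpace K))
    have h : ∀ t : ℝ, (((expGL (t • X))⁻¹ : GL (Fin n) (mixedSpace K)) :
        Matrix (Fin n) (Fin n) (mixedSpace K)) = NormedSpace.exp (t • (-X)) := fun t => by
      rw [← expGL_neg, coe_expGL, smul_neg]
    simp only [h]
    exact NormedSpace.exp_continuous.comp (continuous_id.smul continuous_const)

/-- The curve `t ↦ g · (exp(tX), 1)` in `GL_n(𝔸_K)` is continuous. [folklore] -/
theorem continuous_mul_glArch_expMem (g : GL (Fin n) (AdeleRing (𝓞 K) K))
    (X : (archGroupGL n K).lie) :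
    Continuous fun t : ℝ => g * glArch n K ((archGroupGL n K).expMem (t • X)) := by
  refine continuous_const.mul ?_
  change Continuous fun t : ℝ => GLn.ofInfinite n K
    (expGL (t • (X : Matrix (Fin n) (Fin n) (mixedSpace K))))
  exact (GLn.continuous_ofInfinite n K).comp (continuous_expGL_smul_aux _)

/-- **The support of a Lie derivative lies in the topological support**: if `φ` vanishes near `g`,
so does `t ↦ φ (g · (exp(tX), 1))` near `t = 0`, and its derivative there is `0`. [folklore] -/
theorem support_lieDeriv_subset_tsupport (X : (archGroupGL n K).lie)
    (φ : GL (Fin n) (AdeleRing (𝓞 K) K) → ℂ) :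
    Function.support (lieDeriv (glArch n K) X φ) ⊆ tsupport φ := by
  intro g hg
  by_contra hng
  apply hg
  -- near `t = 0` the curve stays outside `tsupport φ`
  have hcont := continuous_mul_glArch_expMem g X
  have h0 : g * glArch n K ((archGroupGL n K).expMem ((0 : ℝ) • X)) = g := by
    rw [zero_smul]
    change g * GLn.ofInfinite n K (expGL (0 : Matrix (Fin n) (Fin n) (mixedSpace K))) = g
    rw [expGL_zero, map_one, mul_one]
  have hev : ∀ᶠ t in 𝓝 (0 : ℝ), φ (g * glArch n K ((archGroupGL n K).expMem (t • X))) = 0 := by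
    have hopen : IsOpen (tsupport φ)ᶜ := (isClosed_tsupport φ).isOpen_compl
    have hg0 : (fun t : ℝ => g * glArch n K ((archGroupGL n K).expMem (t • X))) 0 ∈
        (tsupport φ)ᶜ := by
      change g * glArch n K ((archGroupGL n K).expMem ((0 : ℝ) • X)) ∈ (tsupport φ)ᶜ
      rwa [h0]
    filter_upwards [hcont.continuousAt.eventually_mem (hopen.mem_nhds hg0)] with t ht
    exact image_eq_zero_of_notMem_tsupport ht
  have hev' : (fun t : ℝ => φ (g * glArch n K ((archGroupGL n K).expMem (t • X)))) =ᶠ[𝓝 0]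
      fun _ => (0 : ℂ) := hev
  change deriv (fun t : ℝ => φ (g * glArch n K ((archGroupGL n K).expMem (t • X)))) 0 = 0
  rw [hev'.deriv_eq]
  exact deriv_const 0 0

/-- The topological support of a Lie derivative lies in that of the function. [folklore] -/
theorem tsupport_lieDeriv_subset (X : (archGroupGL n K).lie)
    (φ : GL (Fin n) (AdeleRing (𝓞 K) K) → ℂ) :
    tsupport (lieDeriv (glArch n K) X φ) ⊆ tsupport φ :=
  closure_minimal (support_lieDeriv_subset_tsupport X φ) (isClosed_tsupport φ)

/-- The topological support of an iterated Lie derivative lies in that of the function.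
[folklore] -/
theorem tsupport_iterLieDeriv_subset (w : List (archGroupGL n K).lie)
    (φ : GL (Fin n) (AdeleRing (𝓞 K) K) → ℂ) :
    tsupport (iterLieDeriv (glArch n K) w φ) ⊆ tsupport φ := by
  induction w with
  | nil => exact subset_rfl
  | cons X w ih => exact (tsupport_lieDeriv_subset X _).trans ih

/-- Lie derivatives of compactly supported functions are compactly supported. [folklore] -/
theorem hasCompactSupport_lieDeriv_gl {φ : GL (Fin n) (AdeleRing (𝓞 K) K) → ℂ}
    (hφ : HasCompactSupport φ) (X : (archGroupGL n K).lie) :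
    HasCompactSupport (lieDeriv (glArch n K) X φ) :=
  hφ.of_isClosed_subset (isClosed_tsupport _) (tsupport_lieDeriv_subset X φ)

end Support

/-! ### Smooth kernels are stable under Lie derivatives -/

/-- **Level invariance passes to Lie derivatives**: if `φ` is right invariant under an admissible
level `U = {1} × U₀`, so is `X φ` (the archimedean one-parameter subgroup `(exp tX, 1)` commutes
with `(1, u)`; Borel–Jacquet (1979), §4.3: `X` commutes with right translations by `G(𝔸_f)`).
[cite: BorelJacquet1979, §4.3] -/
theorem IsRightInvariantUnder.lieDeriv_gl {φ : GL (Fin n) (AdeleRing (𝓞 K) K) → ℂ}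
    {U : Subgroup (GL (Fin n) (AdeleRing (𝓞 K) K))} (hU : U ∈ finiteLevelsGL n K)
    (hφU : IsRightInvariantUnder U φ) (X : (archGroupGL n K).lie) :
    IsRightInvariantUnder U (lieDeriv (glArch n K) X φ) := by
  obtain ⟨U₀, -, -, rfl⟩ := hU
  intro u hu g
  obtain ⟨u₀, hu₀, rfl⟩ := Subgroup.mem_map.1 hu
  have hcomm : ∀ h : (archGroupGL n K).carrier,
      glArch n K h * GLn.ofFinite n K u₀ = GLn.ofFinite n K u₀ * glArch n K h :=
    fun h => glArch_mul_ofFinite_comm h u₀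
  have key := lieDeriv_comp_mul_right (glArch n K) X φ (y := GLn.ofFinite n K u₀) hcomm
  have hinv : (fun g => φ (g * GLn.ofFinite n K u₀)) = φ := funext fun g => hφU _ hu g
  rw [hinv] at key
  exact (congrFun key g).symm

/-- **The Lie derivative of a smooth kernel is a smooth kernel.** [folklore] -/
theorem IsSmoothKernelGL.lieDeriv {η : GL (Fin n) (AdeleRing (𝓞 K) K) → ℂ}
    (hη : IsSmoothKernelGL n K η) (X : (archGroupGL n K).lie) :
    IsSmoothKernelGL n K (lieDeriv (glArch n K) X η) := by
  obtain ⟨U, hU, hηU⟩ := hη.exists_level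
  exact ⟨hη.isArchSmooth.lieDeriv_gl X, hasCompactSupport_lieDeriv_gl hη.hasCompactSupport X,
    U, hU, hηU.lieDeriv_gl hU X⟩

/-- **Iterated Lie derivatives of smooth kernels are smooth kernels.** [folklore] -/
theorem IsSmoothKernelGL.iterLieDeriv {η : GL (Fin n) (AdeleRing (𝓞 K) K) → ℂ}
    (hη : IsSmoothKernelGL n K η) (w : List (archGroupGL n K).lie) :
    IsSmoothKernelGL n K (iterLieDeriv (glArch n K) w η) := by
  induction w with
  | nil => exact hη
  | cons X w ih => exact ih.lieDeriv X

/-! ### Left invariance under an open subgroup of the finite part -/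

/-- A function on a group is **left invariant** under a subgroup `V`: `φ (v g) = φ g`.
[folklore] -/
def IsLeftInvariantUnder {G : Type*} [Group G] (V : Subgroup G) (φ : G → ℂ) : Prop :=
  ∀ v ∈ V, ∀ g, φ (v * g) = φ g

/-- **Left invariance passes to right Lie derivatives** (left translations commute with the
right-invariant... i.e. with differentiation along right translations; no smoothness needed).
Borel (1997), §2.1–2.2. [cite: Borel1997, §2.2 (PDF pp. 48–49)] -/
theorem IsLeftInvariantUnder.lieDeriv_gl {φ : GL (Fin n) (AdeleRing (𝓞 K) K) → ℂ}
    {V : Subgroup (GL (Fin n) (AdeleRing (𝓞 K) K))} (hφ : IsLeftInvariantUnder V φ)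
    (X : (archGroupGL n K).lie) : IsLeftInvariantUnder V (lieDeriv (glArch n K) X φ) := by
  intro v hv g
  simp only [Literature.NumberTheory.Automorphic.lieDeriv]
  congr 1
  funext t
  rw [mul_assoc, hφ v hv]

/-- Left invariance passes to iterated right Lie derivatives. [folklore] -/
theorem IsLeftInvariantUnder.iterLieDeriv_gl {φ : GL (Fin n) (AdeleRing (𝓞 K) K) → ℂ}
    {V : Subgroup (GL (Fin n) (AdeleRing (𝓞 K) K))} (hφ : IsLeftInvariantUnder V φ)
    (w : List (archGroupGL n K).lie) :
    IsLeftInvariantUnder V (iterLieDeriv (glArch n K) w φ) := by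
  induction w with
  | nil => exact hφ
  | cons X w ih => exact ih.lieDeriv_gl X

/-- An element of the level `{1} × U₀` with finite part `1`... more precisely: an element `h` of
`GL_n(𝔸_K)` with trivial archimedean component is `(1, h_f)` (`GLn.ofInfinite_toMixed_mul_ofFinite_sndHom`).
[folklore] -/
theorem eq_ofFinite_sndHom_of_toMixed_eq_one {h : GL (Fin n) (AdeleRing (𝓞 K) K)}
    (hh : GLn.toMixed n K h = 1) : h = GLn.ofFinite n K (GLn.sndHom n K h) := by
  conv_lhs => rw [← GLn.ofInfinite_toMixed_mul_ofFinite_sndHom h]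
  rw [hh, map_one, one_mul]

/-- **A compactly supported function which is right invariant under an admissible level is left
invariant under a principal congruence subgroup.** If `φ` has compact support `C` and
`φ (g u) = φ g` for `u ∈ {1} × U₀` (`U₀` open), there is `𝔫 ≠ 0` with `φ (v g) = φ g` for all
`v ∈ K(𝔫)`: choose `𝔫` with `c⁻¹ v c ∈ {1} × U₀` for all `c ∈ C`, `v ∈ K(𝔫)` (uniform continuity
of conjugation on the compact `C`, `exists_principalCongruenceLevel_subset`); then for `g ∈ C`,
`φ (v g) = φ (g · g⁻¹ v g) = φ g`, and off `C ∪ v⁻¹ C` both sides vanish. [folklore] -/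
theorem exists_isLeftInvariant_of_isRightInvariantUnder {φ : GL (Fin n) (AdeleRing (𝓞 K) K) → ℂ}
    (hφs : HasCompactSupport φ) {U : Subgroup (GL (Fin n) (AdeleRing (𝓞 K) K))}
    (hU : U ∈ finiteLevelsGL n K) (hφU : IsRightInvariantUnder U φ) :
    ∃ 𝔫 : Ideal (𝓞 K), 𝔫 ≠ 0 ∧ IsLeftInvariantUnder (principalCongruenceLevel n K 𝔫) φ := by
  obtain ⟨U₀, hU₀o, -, rfl⟩ := hU
  have hCc : IsCompact (tsupport φ) := hφs
  -- conjugation read through the finite part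
  let κ : GL (Fin n) (AdeleRing (𝓞 K) K) × GL (Fin n) (AdeleRing (𝓞 K) K) →
      GL (Fin n) (FiniteAdeleRing (𝓞 K) K) := fun p => GLn.sndHom n K (p.1⁻¹ * p.2 * p.1)
  have hκ : Continuous κ :=
    GLn.continuous_sndHom.comp ((continuous_fst.inv.mul continuous_snd).mul continuous_fst)
  have hP : IsOpen (κ ⁻¹' (U₀ : Set (GL (Fin n) (FiniteAdeleRing (𝓞 K) K)))) := hU₀o.preimage hκ
  have hκ1 : ∀ c : GL (Fin n) (AdeleRing (𝓞 K) K), κ (c, 1) = 1 := fun c => by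
    simp only [κ, mul_one, inv_mul_cancel, map_one]
  have hsub : tsupport φ ×ˢ ({1} : Set (GL (Fin n) (AdeleRing (𝓞 K) K))) ⊆
      κ ⁻¹' (U₀ : Set (GL (Fin n) (FiniteAdeleRing (𝓞 K) K))) := by
    rintro ⟨c, v⟩ ⟨-, hv⟩
    have hv' : v = 1 := hv
    subst hv'
    rw [Set.mem_preimage, hκ1]
    exact U₀.one_mem
  -- tube lemma over the compact support
  obtain ⟨A, B, -, hB, hCA, h1B, hAB⟩ :=
    generalized_tube_lemma hCc isCompact_singleton hP hsub
  have hBn : B ∈ 𝓝 (1 : GL (Fin n) (AdeleRing (𝓞 K) K)) := hB.mem_nhds (h1B (Set.mem_singleton 1))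
  obtain ⟨𝔫, h𝔫, hsub𝔫⟩ := exists_principalCongruenceLevel_subset n K hBn
  refine ⟨𝔫, h𝔫, ?_⟩
  -- the conjugates `c⁻¹ v c`, `c ∈ tsupport φ`, `v ∈ K(𝔫)`, lie in the level `{1} × U₀`
  have hconj : ∀ v ∈ principalCongruenceLevel n K 𝔫, ∀ c ∈ tsupport φ,
      c⁻¹ * v * c ∈ U₀.map (GLn.ofFinite n K) := by
    intro v hv c hc
    have hfin : κ (c, v) ∈ U₀ := hAB (Set.mk_mem_prod (hCA hc) (hsub𝔫 hv))
    have h1 : GLn.toMixed n K (c⁻¹ * v * c) = 1 := by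
      have hv1 : GLn.toMixed n K v = 1 := by
        have := (mem_glIntegralLevel_iff.1 (principalCongruenceLevel_le n K 𝔫 hv)).2
        rw [GLn.toMixed_apply, this, map_one]
      rw [map_mul, map_mul, hv1, mul_one, ← map_mul, inv_mul_cancel, map_one]
    rw [eq_ofFinite_sndHom_of_toMixed_eq_one h1]
    exact Subgroup.mem_map.2 ⟨_, hfin, rfl⟩
  have hmain : ∀ v ∈ principalCongruenceLevel n K 𝔫, ∀ g ∈ tsupport φ, φ (v * g) = φ g := by
    intro v hv g hg
    have : v * g = g * (g⁻¹ * v * g) := by group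
    rw [this]
    exact hφU _ (hconj v hv g hg) g
  intro v hv g
  by_cases hg : g ∈ tsupport φ
  · exact hmain v hv g hg
  · by_cases hvg : v * g ∈ tsupport φ
    · -- apply the main case to `v⁻¹` and `v g`
      have h := hmain v⁻¹ ((principalCongruenceLevel n K 𝔫).inv_mem hv) (v * g) hvg
      rw [inv_mul_cancel_left] at h
      exact h.symm
    · rw [image_eq_zero_of_notMem_tsupport hg, image_eq_zero_of_notMem_tsupport hvg]

/-- **A smooth kernel and all its iterated right Lie derivatives are left invariant under one
principal congruence subgroup.** [folklore] -/
theorem IsSmoothKernelGL.exists_isLeftInvariant_iterLieDeriv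
    {η : GL (Fin n) (AdeleRing (𝓞 K) K) → ℂ} (hη : IsSmoothKernelGL n K η) :
    ∃ 𝔫 : Ideal (𝓞 K), 𝔫 ≠ 0 ∧ ∀ w : List (archGroupGL n K).lie,
      IsLeftInvariantUnder (principalCongruenceLevel n K 𝔫)
        (Literature.NumberTheory.Automorphic.iterLieDeriv (glArch n K) w η) := by
  obtain ⟨U, hU, hηU⟩ := hη.exists_level
  obtain ⟨𝔫, h𝔫, hleft⟩ := exists_isLeftInvariant_of_isRightInvariantUnder hη.hasCompactSupport hU hηU
  exact ⟨𝔫, h𝔫, fun w => hleft.iterLieDeriv_gl w⟩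

/-! ### Iterated derivatives: smoothness, linearity, homogeneity, continuity in the directions -/

section Iterated

/-- Iterated Lie derivatives of archimedean-smooth functions are archimedean-smooth
(`IsArchSmooth.lieDeriv_gl` iterated). [cite: BorelJacquet1979, §1.5] -/
theorem IsArchSmooth.iterLieDeriv_gl {φ : GL (Fin n) (AdeleRing (𝓞 K) K) → ℂ}
    (hφ : IsArchSmooth (glArch n K) φ) (w : List (archGroupGL n K).lie) :
    IsArchSmooth (glArch n K) (iterLieDeriv (glArch n K) w φ) := by
  induction w with
  | nil => exact hφ
  | cons X w ih => exact ih.lieDeriv_gl X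

/-- **Linearity of iterated Lie derivatives in the function**, on finite linear combinations of
smooth functions (`IsArchSmooth.lieDeriv_finset_sum_smul` iterated).
[cite: BorelJacquet1979, §1.5] -/
theorem iterLieDeriv_finset_sum_smul (w : List (archGroupGL n K).lie) {J : Type*} (s : Finset J)
    (c : J → ℂ) {ψ : J → GL (Fin n) (AdeleRing (𝓞 K) K) → ℂ}
    (hψ : ∀ j, IsArchSmooth (glArch n K) (ψ j)) :
    iterLieDeriv (glArch n K) w (∑ j ∈ s, c j • ψ j) =
      ∑ j ∈ s, c j • iterLieDeriv (glArch n K) w (ψ j) := by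
  induction w with
  | nil => rfl
  | cons X w ih =>
    rw [iterLieDeriv_cons, ih, IsArchSmooth.lieDeriv_finset_sum_smul (glArch n K) X s c
      (fun j => (hψ j).iterLieDeriv_gl w)]
    rfl

/-- **Homogeneity of iterated Lie derivatives in the directions**: for smooth `φ`,
`(r₁X₁) ⋯ (r_B X_B) φ = (∏ rᵢ) · X₁ ⋯ X_B φ`. [cite: BorelJacquet1979, §1.5] -/
theorem IsArchSmooth.iterLieDeriv_ofFn_smul {φ : GL (Fin n) (AdeleRing (𝓞 K) K) → ℂ}
    (hφ : IsArchSmooth (glArch n K) φ) {B : ℕ} (r : Fin B → ℝ)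
    (v : Fin B → (archGroupGL n K).lie) :
    iterLieDeriv (glArch n K) (List.ofFn fun i => r i • v i) φ =
      ((∏ i, r i : ℝ) : ℂ) • iterLieDeriv (glArch n K) (List.ofFn v) φ := by
  induction B with
  | zero => simp [List.ofFn_zero]
  | succ B ih =>
    rw [List.ofFn_succ, List.ofFn_succ, iterLieDeriv_cons, iterLieDeriv_cons,
      ih (fun i => r i.succ) (fun i => v i.succ), Fin.prod_univ_succ]
    have hs : IsArchSmooth (glArch n K)
        (iterLieDeriv (glArch n K) (List.ofFn fun i : Fin B => v i.succ) φ) :=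
      hφ.iterLieDeriv_gl _
    rw [lieDeriv_smul, hs.lieDeriv_smul_left (glArch n K), real_smul_fun_eq_coe_smul, smul_smul,
      Complex.ofReal_mul, mul_comm]

-- `M_n(K_∞)` is finite-dimensional over `ℝ` (`finiteDimensional_matrix_mixedSpace` of
-- `GLnCuspidalSpectrumSiegelProofs`, a theorem used as a local instance, as there)
attribute [local instance] finiteDimensional_matrix_mixedSpace

variable (n K) in
/-- A real basis of `𝔤𝔩_n(K_∞) = M_n(K_∞)` (Mathlib's `Module.finBasis`). [folklore] -/
def glInfBasis : Module.Basis (Fin (Module.finrank ℝ (Matrix (Fin n) (Fin n) (mixedSpace K)))) ℝ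
    (Matrix (Fin n) (Fin n) (mixedSpace K)) :=
  Module.finBasis ℝ _

/-- **Expansion of a Lie derivative in the basis**: for smooth `φ`,
`X φ = Σ_e x_e · (b_e φ)` with `x_e` the coordinates of `X` (`ℝ`-linearity of `X ↦ X φ`,
`IsArchSmooth.lieDeriv_sum_smul_left`). Borel (1997), proof of Lemma 7.4
("`Ad k_x⁻¹(Y) = Σ cᵢ(k_x⁻¹) Xᵢ`, therefore `(-Y * f)(x) = … Σ cᵢ(k_x⁻¹) Xᵢ f(x)`").
[cite: Borel1997, Lemma 7.4 (PDF p. 61)] -/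
theorem IsArchSmooth.lieDeriv_eq_sum_coord {φ : GL (Fin n) (AdeleRing (𝓞 K) K) → ℂ}
    (hφ : IsArchSmooth (glArch n K) φ) (X : (archGroupGL n K).lie) :
    lieDeriv (glArch n K) X φ =
      ∑ e, (glInfBasis n K).coord e (X : Matrix (Fin n) (Fin n) (mixedSpace K)) •
        lieDeriv (glArch n K) (lieOf (glInfBasis n K e)) φ := by
  have hX : X = ∑ e, (glInfBasis n K).coord e (X : Matrix (Fin n) (Fin n) (mixedSpace K)) •
      lieOf (glInfBasis n K e) := by
    apply Subtype.ext
    rw [AddSubmonoidClass.coe_finsetSum]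
    change (X : Matrix (Fin n) (Fin n) (mixedSpace K)) =
      ∑ e, (glInfBasis n K).repr (X : Matrix (Fin n) (Fin n) (mixedSpace K)) e • glInfBasis n K e
    rw [(glInfBasis n K).sum_repr]
  conv_lhs => rw [hX]
  rw [hφ.lieDeriv_sum_smul_left (glArch n K)]

/-- **Expansion of the last derivative**: for smooth `φ` and directions `v₀, …, v_B`,
`v₀ ⋯ v_B φ = Σ_e (v_B)_e · v₀ ⋯ v_{B-1} (b_e φ)`. [cite: Borel1997, Lemma 7.4 (PDF p. 61)] -/
theorem IsArchSmooth.iterLieDeriv_ofFn_succ_eq_sum {φ : GL (Fin n) (AdeleRing (𝓞 K) K) → ℂ}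
    (hφ : IsArchSmooth (glArch n K) φ) {B : ℕ} (v : Fin (B + 1) → (archGroupGL n K).lie) :
    iterLieDeriv (glArch n K) (List.ofFn v) φ =
      ∑ e, ((glInfBasis n K).coord e
          (v (Fin.last B) : Matrix (Fin n) (Fin n) (mixedSpace K)) : ℂ) •
        iterLieDeriv (glArch n K) (List.ofFn fun i : Fin B => v i.castSucc)
          (lieDeriv (glArch n K) (lieOf (glInfBasis n K e)) φ) := by
  rw [List.ofFn_succ', List.concat_eq_append, iterLieDeriv_append]
  change iterLieDeriv (glArch n K) (List.ofFn fun i : Fin B => v i.castSucc)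
      (lieDeriv (glArch n K) (v (Fin.last B)) φ) = _
  rw [hφ.lieDeriv_eq_sum_coord (v (Fin.last B))]
  have hsm : ∀ e, IsArchSmooth (glArch n K)
      (lieDeriv (glArch n K) (lieOf (glInfBasis n K e)) φ) := fun e => hφ.lieDeriv_gl _
  simp_rw [real_smul_fun_eq_coe_smul]
  rw [iterLieDeriv_finset_sum_smul _ _ _ hsm]

/-- **Joint continuity of iterated derivatives of a smooth kernel in the directions and the
point**: `(v, g) ↦ (v₀ ⋯ v_{B-1} η)(g)` is continuous on `𝔤𝔩_n(K_∞)^B × GL_n(𝔸_K)` (induction on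
`B` through the expansion of the last derivative: the coordinates are continuous linear forms on
the finite-dimensional `𝔤𝔩_n(K_∞)`, and each `b_e η` is again a smooth kernel). [folklore] -/
theorem IsSmoothKernelGL.continuous_iterLieDeriv_ofFn {η : GL (Fin n) (AdeleRing (𝓞 K) K) → ℂ}
    (hη : IsSmoothKernelGL n K η) (B : ℕ) :
    Continuous fun p : (Fin B → (archGroupGL n K).lie) × GL (Fin n) (AdeleRing (𝓞 K) K) =>
      Literature.NumberTheory.Automorphic.iterLieDeriv (glArch n K) (List.ofFn p.1) η p.2 := by
  induction B generalizing η with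
  | zero =>
    simp only [List.ofFn_zero, iterLieDeriv_nil]
    exact hη.continuous.comp continuous_snd
  | succ B ih =>
    have hcoord : ∀ e, Continuous fun X : Matrix (Fin n) (Fin n) (mixedSpace K) =>
        (glInfBasis n K).coord e X := fun e =>
      ((glInfBasis n K).coord e).continuous_of_finiteDimensional
    simp only [hη.isArchSmooth.iterLieDeriv_ofFn_succ_eq_sum, Finset.sum_apply, Pi.smul_apply,
      smul_eq_mul]
    refine continuous_finsetSum _ fun e _ => ?_
    refine Continuous.mul ?_ ?_
    · exact Complex.continuous_ofReal.comp ((hcoord e).comp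
        (continuous_subtype_val.comp ((continuous_apply (Fin.last B)).comp continuous_fst)))
    · have h := ih (hη.lieDeriv (lieOf (glInfBasis n K e)))
      exact h.comp ((continuous_pi fun i => (continuous_apply i.castSucc).comp continuous_fst).prodMk
        continuous_snd)

/-- **Iterated derivatives of a smooth kernel are uniformly bounded over compact sets of direction
tuples**: for compact `S ⊆ 𝔤𝔩_n(K_∞)^B` there is `M` with `‖(v₀ ⋯ v_{B-1} η)(g)‖ ≤ M` for all
`v ∈ S` and all `g ∈ GL_n(𝔸_K)` (continuity on `S × tsupport η`, and the derivatives vanish off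
`tsupport η`). This is the form in which Borel's "the functions `|cᵢ|` are bounded on `K`"
(Lemma 7.4) enters the basic estimate. [cite: Borel1997, Lemma 7.4 (PDF p. 61)] -/
theorem IsSmoothKernelGL.exists_forall_norm_iterLieDeriv_ofFn_le
    {η : GL (Fin n) (AdeleRing (𝓞 K) K) → ℂ} (hη : IsSmoothKernelGL n K η) {B : ℕ}
    {S : Set (Fin B → (archGroupGL n K).lie)} (hS : IsCompact S) :
    ∃ M : ℝ, 0 ≤ M ∧ ∀ v ∈ S, ∀ g,
      ‖Literature.NumberTheory.Automorphic.iterLieDeriv (glArch n K) (List.ofFn v) η g‖ ≤ M := by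
  have hc := hη.continuous_iterLieDeriv_ofFn B
  -- bounded on the compact `S × tsupport η`
  obtain ⟨M, hM⟩ := (hS.prod hη.hasCompactSupport).exists_bound_of_continuousOn
    (f := fun p : (Fin B → (archGroupGL n K).lie) × GL (Fin n) (AdeleRing (𝓞 K) K) =>
      Literature.NumberTheory.Automorphic.iterLieDeriv (glArch n K) (List.ofFn p.1) η p.2)
    hc.continuousOn
  refine ⟨max M 0, le_max_right _ _, fun v hv g => ?_⟩
  by_cases hg : g ∈ tsupport η
  · exact (hM (v, g) (Set.mk_mem_prod hv hg)).trans (le_max_left _ _)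
  · have h0 : Literature.NumberTheory.Automorphic.iterLieDeriv (glArch n K) (List.ofFn v) η g = 0 := by
      by_contra hne
      exact hg (tsupport_iterLieDeriv_subset (List.ofFn v) η (subset_tsupport _ hne))
    rw [h0, norm_zero]
    exact le_max_right _ _

end Iterated

end Literature.NumberTheory.Automorphic
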